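import Summits.Ventures.PercRepro.Conditioning
import Summits.Ventures.PercRepro.Cluster

/-!
# Isolated vertices

`G.isolatedEvent v`: no open edge of `ω` touches `v`, i.e. every edge incident to `v` is closed.
It is a decreasing event and the cylinder «`G.incidentEdges v` closed», so its probability is the
product `∏_{e ∋ v} (1 - p_e)` (`prob_isolatedEvent`: the isolation probability `I_v` of the
isolation-type lemmas); on it the open cluster of `v` is `{v}` and `v` is separated from every
other vertex.  `cluster_eq_singleton_iff` characterises `C_v = {v}` in general (open loops at `v`
are allowed there, not in `isolatedEvent`).
-/

namespace PercRepro

namespace MultiGraph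

variable {V E : Type*} (G : MultiGraph V E)

/-- `G.isolatedEvent v`: every edge incident to `v` is closed. -/
def isolatedEvent (v : V) : Set (Config E) :=
  {ω | ∀ e, ω e = true → G.fst e ≠ v ∧ G.snd e ≠ v}

/-- Membership in the isolation event. -/
theorem mem_isolatedEvent {v : V} {ω : Config E} :
    ω ∈ G.isolatedEvent v ↔ ∀ e, ω e = true → G.fst e ≠ v ∧ G.snd e ≠ v :=
  Iff.rfl

variable {G}

/-- Isolation is a decreasing event. -/
theorem isLowerSet_isolatedEvent (v : V) : IsLowerSet (G.isolatedEvent v) := by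
  intro ω ω' hle hω e he
  exact hω e (Config.le_iff.1 hle e he)

/-- On the isolation event the open cluster of `v` is `{v}`. -/
theorem cluster_eq_singleton_of_mem_isolatedEvent {v : V} {ω : Config E}
    (hω : ω ∈ G.isolatedEvent v) : G.cluster ω v = {v} := by
  ext u
  simp only [mem_cluster, Set.mem_singleton_iff]
  exact ⟨fun h => eq_of_conn_of_isolated hω h, fun h => h ▸ Conn.refl G ω v⟩

/-- An isolated vertex is separated from every other vertex. -/
theorem mem_sepEvent_of_mem_isolatedEvent {v w : V} (hvw : w ≠ v) {ω : Config E}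
    (hω : ω ∈ G.isolatedEvent v) : ω ∈ G.sepEvent v w := by
  rw [mem_sepEvent]
  exact fun h => hvw (eq_of_conn_of_isolated hω h)

/-- `isolatedEvent v ⊆ R_{V ∖ {v}}`: an isolated vertex is joined to no other vertex. -/
theorem isolatedEvent_subset_sepAllEvent (v : V) :
    G.isolatedEvent v ⊆ G.sepAllEvent v {v}ᶜ := by
  intro ω hω x hx h
  exact hx (eq_of_conn_of_isolated hω h)

/-- **The cluster of `v` is `{v}`** iff no open edge joins `v` to another vertex (open loops at
`v` are allowed). -/
theorem cluster_eq_singleton_iff {v : V} {ω : Config E} :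
    G.cluster ω v = {v} ↔
      ∀ e, ω e = true → (G.fst e = v → G.snd e = v) ∧ (G.snd e = v → G.fst e = v) := by
  constructor
  · intro h e he
    have hmem : ∀ u, G.Conn ω v u → u = v := fun u hu => by
      have : u ∈ G.cluster ω v := (G.mem_cluster).2 hu
      rw [h] at this
      exact this
    refine ⟨fun h1 => ?_, fun h2 => ?_⟩
    · exact hmem _ (Conn.of_openAdj (h1 ▸ G.openAdj_of_open e he))
    · exact hmem _ (Conn.of_openAdj (h2 ▸ (G.openAdj_of_open e he).symm))
  · intro h
    ext u
    simp only [mem_cluster, Set.mem_singleton_iff]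
    refine ⟨fun hu => ?_, fun hu => hu ▸ Conn.refl G ω v⟩
    refine mem_of_conn_of_closed_boundary (X := {v}) (fun e he => ?_) rfl hu
    simp only [Set.mem_singleton_iff]
    exact ⟨(h e he).1, (h e he).2⟩

section Cylinder

variable (G) [DecidableEq V]

/-- The edges incident to `v` (loops at `v` included). -/
def incidentEdges [Fintype E] (v : V) : Finset E :=
  Finset.univ.filter fun e => G.fst e = v ∨ G.snd e = v

/-- Membership in the incident edge set. -/
theorem mem_incidentEdges [Fintype E] {v : V} {e : E} :
    e ∈ G.incidentEdges v ↔ G.fst e = v ∨ G.snd e = v := by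
  simp [incidentEdges]

/-- Isolation is the cylinder «all incident edges closed». -/
theorem isolatedEvent_eq_cylinder [Fintype E] (v : V) :
    G.isolatedEvent v = cylinder ∅ (G.incidentEdges v) := by
  ext ω
  rw [mem_isolatedEvent, mem_cylinder]
  simp only [Finset.notMem_empty, false_implies, implies_true, true_and, mem_incidentEdges]
  constructor
  · intro h e he
    cases hωe : ω e
    · rfl
    · rcases he with h1 | h2
      · exact absurd h1 (h e hωe).1
      · exact absurd h2 (h e hωe).2
  · intro h e he
    refine ⟨fun h1 => ?_, fun h2 => ?_⟩
    · rw [h e (Or.inl h1)] at he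
      exact Bool.false_ne_true he
    · rw [h e (Or.inr h2)] at he
      exact Bool.false_ne_true he

/-- **Isolation probability**: `P_p(v isolated) = ∏_{e ∋ v} (1 - p_e)`. -/
theorem prob_isolatedEvent [Fintype E] [DecidableEq E] (p : E → ℝ) (v : V) :
    prob p (G.isolatedEvent v) = ∏ e ∈ G.incidentEdges v, (1 - p e) := by
  rw [isolatedEvent_eq_cylinder, prob_cylinder p (Finset.disjoint_empty_left _),
    Finset.prod_empty, one_mul]

end Cylinder

end MultiGraph

end PercRepro
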